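import Summits.PneNP.PneNP.Theorems.ChebyshevTracialDesignPseudoMatchingBaseTransport
import Summits.PneNP.PneNP.Theorems.ChebyshevTracialDesignJuntaLowDegree
import Literature.Barriers.PneNP.MatchingSlackPsdApproximation
import Literature.Combinatorics.Optimization.ChebyshevExtrapolationDesign
import Literature.Computability.Complexity.KnapsackSosDegree

/-!
# Cell pnp-psdrank, route `ChebyshevTracialDesign`: PSD FACTORIZATIONS OF THE MATCHING SLACK MATRIX HAVE HIGH-DEGREE FACTORS — a
# dimension-free, unconditional structural theorem (crux `TracialDecayExp20`, stmt-PneNP-19878; eng g14, MEMO-14 §6)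

The cell's two «low-degree immune class» pricings — cut side: `…JuntaLowDegree.sum_levelWeight_trace_nonpos_of_lowDegree` (Johnson-degree
`≤ k` cut factors, arbitrary psd matching side; unconditional since `Grigoriev2001_knapsackFormNonneg_holds`), matching side:
`…PseudoMatchingBaseTransport.sum_levelWeight_trace_nonpos_of_lowDegreeM` (matching-degree `≤ k` matching factors, arbitrary psd cut side;
unconditional via littype-FN2-1's story-PSD range and the base recursion) — say that an exact design prices such strategies at `≤ 0`, while
Rothvoß's double count (re-proved here route-independently, `sum_levelWeight_mul_eq_of_agree`) gives the slack matrix itself design value `Σ_c w_c (c − 1) = 1` [cite: Rothvoss2017, §2 (PDF p. 6, eq. (2))]. Read against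
an actual psd factorization `S_{UM} = |δ(U) ∩ M| − 1 = tr(X_U Y_M)` this is a statement about the OBJECT:
* **`psd_factors_not_lowDegree`** — for all large even `n` there is a balanced odd cut size `t` (`n ≤ 4t`, `2t + 2 ≤ n`) such that for EVERY
  `k ≤ dq(n)/2` (`dq n ≍ n^{1/4}`) and every psd factorization of the odd-cut slack matrix on the `t`-cuts, OF ANY DIMENSION `r`:
  no Gram factor `B_M` (`Y_M = B_M B_Mᵀ`, `X_U` arbitrary psd) has matching-degree `≤ k` (`¬ IsLowDegreeM n k B`: some entry of `M ↦ B_M` is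
  outside the span of the monomials `1[F ⊆ M]`, `|F| ≤ k`), and no Gram factor `A_U` (`X_U = A_U A_Uᵀ`, `Y_M` arbitrary psd) has
  Johnson-degree `≤ k` (`¬ IsLowDegreeU n k A`).
So every psd lift of the perfect matching polytope — whatever its size — uses factor maps of polynomial degree `> n^{1/4}/2` on BOTH sides
[cite: LeeRaghavendraSteurer2015, §5 (low-degree matrix-valued functions)] [cite: FawziEtAl2015, §5.2]. Stature: paper-sized remark / instrument
(dimension-free and unconditional, but a DEGREE bound, not a SIZE bound: nothing on psd rank, no P-vs-NP content); axioms standard; no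
definitions. Supports stmt-PneNP-19878.
-/

set_option linter.dupNamespace false -- `Summit.PneNP.PneNP.…`: summit = sub-problem (D-0017)

noncomputable section

namespace Summit.PneNP.PneNP.Theorems.ChebyshevTracialDesignPsdFactorDegree

open Finset Matrix Literature.Barriers.PneNP Literature.Combinatorics.Optimization
open Literature.Computability.Complexity (Grigoriev2001_knapsackFormNonneg_holds)
open Summit.PneNP.PneNP.Theorems.ChebyshevTracialDesignJunta (sum_levelWeight_trace_nonpos_of_lowDegree)
open Summit.PneNP.PneNP.Theorems.ChebyshevTracialDesignPseudoMatchingBaseTransport (sum_levelWeight_trace_nonpos_of_lowDegreeM)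
open scoped MatrixOrder

variable {n : ℕ}

/-- `12·dq n + 4 ≤ n` for `n ≥ 28` (`(dq n)^4 ≤ n`). [folklore] -/
theorem twelve_mul_dq_add_four_le (hn : 28 ≤ n) : 12 * dq n + 4 ≤ n := by
  have h4 : dq n ^ 4 ≤ n := by
    have h1 : dq n * dq n ≤ Nat.sqrt n := Nat.sqrt_le (Nat.sqrt n)
    calc dq n ^ 4 = (dq n * dq n) * (dq n * dq n) := by ring
      _ ≤ Nat.sqrt n * Nat.sqrt n := Nat.mul_le_mul h1 h1
      _ ≤ n := Nat.sqrt_le n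
  rcases Nat.lt_or_ge (dq n) 3 with h | h
  · omega
  · have h27 : 27 * dq n ≤ dq n ^ 4 := by
      calc 27 * dq n = 3 ^ 3 * dq n := by norm_num
        _ ≤ dq n ^ 3 * dq n := Nat.mul_le_mul_right _ (Nat.pow_le_pow_left h 3)
        _ = dq n ^ 4 := by ring
    omega

/-- The design value of a kernel that AGREES WITH THE SLACK on the `t`-cuts is `Σ_c w_c (c − 1)` (Rothvoß's double count, for any
kernel; route-independent re-proof of `…StretchedExpAssembly.sum_levelWeight_mul_slack`). [cite: Rothvoss2017, §2 (PDF p. 6, eq. (2))] -/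
theorem sum_levelWeight_mul_eq_of_agree {t : ℕ} {C : Finset ℕ} {w : ℕ → ℝ} (hne : ∀ c ∈ C, (Qset n t c).Nonempty)
    (K : OddSet n → PMatch n → ℝ) (hK : ∀ U M, U.1.card = t → K U M = pmOddCutSlack n U M) :
    ∑ U, ∑ M, levelWeight n t C w U M * K U M = ∑ c ∈ C, w c * ((c : ℝ) - 1) := by
  classical
  have h1 : ∀ U M, levelWeight n t C w U M * K U M =
      ∑ c ∈ C, (if (U, M) ∈ Qset n t c then w c / ((Qset n t c).card : ℝ) * K U M else 0) := by
    intro U M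
    unfold levelWeight
    rw [sum_mul]
    exact sum_congr rfl fun c _ => by split_ifs <;> simp
  simp_rw [h1]
  calc ∑ U, ∑ M, ∑ c ∈ C, (if (U, M) ∈ Qset n t c then w c / ((Qset n t c).card : ℝ) * K U M else 0)
      = ∑ U, ∑ c ∈ C, ∑ M, (if (U, M) ∈ Qset n t c then w c / ((Qset n t c).card : ℝ) * K U M else 0) :=
        sum_congr rfl fun U _ => sum_comm
    _ = ∑ c ∈ C, ∑ U, ∑ M, (if (U, M) ∈ Qset n t c then w c / ((Qset n t c).card : ℝ) * K U M else 0) := sum_comm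
    _ = ∑ c ∈ C, w c * ((c : ℝ) - 1) := by
        refine sum_congr rfl fun c hc => ?_
        rw [sum_sum_ite_mem (Qset n t c) fun U M => w c / ((Qset n t c).card : ℝ) * K U M]
        have hval : ∀ p ∈ Qset n t c, w c / ((Qset n t c).card : ℝ) * K p.1 p.2 =
            w c / ((Qset n t c).card : ℝ) * ((c : ℝ) - 1) := by
          intro p hp
          obtain ⟨hpt, hpc⟩ := mem_Qset_iff.1 hp
          rw [hK p.1 p.2 hpt, pmOddCutSlack_apply, hpc]
        rw [sum_congr rfl hval, sum_const, nsmul_eq_mul]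
        have hcard : ((Qset n t c).card : ℝ) ≠ 0 := by
          exact_mod_cast (card_pos.2 (hne c hc)).ne'
        field_simp

/-- **PSD FACTORS OF THE MATCHING SLACK ARE NOT LOW-DEGREE (both sides, any dimension).** For all large even `n` there is a balanced odd
cut size `t` such that for every `k` with `2k ≤ dq n`: (i) if `X_U ⪰ 0` (any `r × r`) and `B_M` (`r × m`) satisfy `tr(X_U B_M B_Mᵀ) = |δ(U) ∩ M| − 1`
for all `t`-cuts `U` and all perfect matchings `M`, then `B` is NOT of matching-degree `≤ k`; (ii) if `A_U` (`r × m`) and `Y_M ⪰ 0` satisfy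
`tr(A_U A_Uᵀ Y_M) = |δ(U) ∩ M| − 1` on the `t`-cuts, then `A` is NOT of Johnson-degree `≤ k`. (An exact design of degree `dq n` prices both
classes at `≤ 0` while the slack has design value `1`.) [cite: Rothvoss2017, §2 (PDF p. 6)] [cite: LeeRaghavendraSteurer2015, §5] -/
theorem psd_factors_not_lowDegree :
    ∃ n₀ : ℕ, ∀ n : ℕ, n₀ ≤ n → Even n → ∃ t : ℕ, Odd t ∧ n ≤ 4 * t ∧ 2 * t + 2 ≤ n ∧
      ∀ k : ℕ, 2 * k ≤ dq n →
        (∀ (r m : ℕ) (X : OddSet n → Matrix (Fin r) (Fin r) ℝ) (B : PMatch n → Matrix (Fin r) (Fin m) ℝ),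
          (∀ U, (X U).PosSemidef) →
          (∀ U M, U.1.card = t → (X U * (B M * (B M)ᵀ)).trace = pmOddCutSlack n U M) →
          ¬ IsLowDegreeM n k B) ∧
        (∀ (r m : ℕ) (A : OddSet n → Matrix (Fin r) (Fin m) ℝ) (Y : PMatch n → Matrix (Fin r) (Fin r) ℝ),
          (∀ M, (Y M).PosSemidef) →
          (∀ U M, U.1.card = t → (A U * (A U)ᵀ * Y M).trace = pmOddCutSlack n U M) →
          ¬ IsLowDegreeU n k A) := by
  obtain ⟨n₁, hdesign⟩ := chebyshevDesignExistsBal_twenty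
  refine ⟨max n₁ 28, fun n hn hev => ?_⟩
  obtain ⟨t, C, w, hbal⟩ := hdesign n (le_trans (le_max_left _ _) hn) hev
  obtain ⟨hdes, h4t⟩ := hbal
  have htodd : Odd t := hdes.1
  have htn : 2 * t + 2 ≤ n := hdes.2.1
  have hne : ∀ c ∈ C, (Qset n t c).Nonempty := fun c hc => (hdes.2.2.2.1 c hc).2.2.2
  have hnorm : ∑ c ∈ C, w c * ((c : ℝ) - 1) = 1 := hdes.2.2.2.2.1
  have hdq : 12 * dq n + 4 ≤ n := twelve_mul_dq_add_four_le (le_trans (le_max_right _ _) hn)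
  refine ⟨t, htodd, h4t, htn, fun k hk => ⟨?_, ?_⟩⟩
  · intro r m X B hX hagree hB
    have hkt : 6 * k + 1 ≤ t := by omega
    have hknt : 6 * k + 1 ≤ n - t := by omega
    have hle := sum_levelWeight_trace_nonpos_of_lowDegreeM hev hdes hk hkt hknt X hX B hB
    have heq := sum_levelWeight_mul_eq_of_agree (w := w) hne (fun U M => (X U * (B M * (B M)ᵀ)).trace) hagree
    rw [heq, hnorm] at hle
    linarith
  · intro r m A Y hY hagree hA
    have h4k : 4 * k ≤ t := by omega
    have hle := sum_levelWeight_trace_nonpos_of_lowDegree Grigoriev2001_knapsackFormNonneg_holds hdes hk h4k A hA Y hY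
    have heq := sum_levelWeight_mul_eq_of_agree (w := w) hne (fun U M => (A U * (A U)ᵀ * Y M).trace) hagree
    rw [heq, hnorm] at hle
    linarith

end Summit.PneNP.PneNP.Theorems.ChebyshevTracialDesignPsdFactorDegree
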